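import Literature.Algebra.Homology.ExtOfAcyclicResolutionFunctoriality
import Mathlib.Algebra.Homology.ShortComplex.ModuleCat
import Mathlib.RingTheory.Finiteness.Basic
import HarnessLib

/-!
# Transfer of homology along degreewise additive bijections
# (an `ℕ`-indexed complex of abelian groups versus a `ℤ`-indexed complex of modules)

Pure homological algebra (Weibel, *An introduction to homological algebra*, §1.1–1.2: homology is
functorial in chain maps, and a chain map which is a degreewise isomorphism induces isomorphisms on
homology), in the CONCRETE form needed to compare two models of one Čech complex living in different
categories, index types and universes: `K` a cochain complex of abelian groups indexed by `ℕ` (e.g.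
`Hom(𝒪_X, Č•(𝓤, M))` built from `Ext⁰`, universe `w`) and `L` a cochain complex of `A`-modules indexed
by `ℤ` (e.g. the ordered Čech complex of a family of submodules of `K(X)`, universe `v`), together with
additive bijections `e n : Kⁿ ≃+ Lⁿ` (`n : ℕ`) intertwining the differentials.

* `kerAddEquiv e he n` — `ker(d : Kⁿ⁺¹ → Kⁿ⁺²) ≃+ ker(d : Lⁿ⁺¹ → Lⁿ⁺²)`, carrying `Im(Kⁿ)` onto `Im(Lⁿ)`
  (`map_range_eq`);
* **`homologyAddEquiv e he n : Hⁿ⁺¹(K) ≃+ Hⁿ⁺¹(L)`** — through Mathlib's concrete descriptions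
  `ShortComplex.abHomologyIso` and `ShortComplex.moduleCatHomologyIso` of the homology in positive
  degrees `n + 1` (where the predecessor index exists on both sides);
* **`homologyAddEquiv_homologyMap_of_smul`** — if a cochain endomorphism `ψ` of `K` acts through `e`
  as the scalar `a ∈ A` (`e n (ψⁿ x) = a • e n x`), then `Hⁿ⁺¹(ψ)` is carried to multiplication by `a`;
* `Module.Finite.of_addEquiv_semilinear` — finiteness descends along an additive bijection that is
  semilinear for a SURJECTIVE ring map (e.g. a ring isomorphism `k ≅ Γ(Spec k, 𝒪)`).

Everything is proved; no named facts.

## References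
* C. A. Weibel, *An introduction to homological algebra*, CUP (1994), §1.1 (Def. 1.1.1, Ex. 1.1.2),
  §1.2. [Weibel1994]
-/

noncomputable section

universe w v v'

open CategoryTheory CategoryTheory.Limits

namespace Literature.Algebra.Homology

namespace HomologyTransfer

variable {A : Type v'} [Ring A] {K : CochainComplex AddCommGrpCat.{w} ℕ}
  {L : CochainComplex (ModuleCat.{v} A) ℤ}
  (e : ∀ n : ℕ, (K.X n : Type w) ≃+ (L.X (n : ℤ) : Type v))
  (he : ∀ (n : ℕ) (x : K.X n),
    e (n + 1) ((K.d n (n + 1)).hom x) = (L.d (n : ℤ) ((n + 1 : ℕ) : ℤ)).hom (e n x))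

/-- The short complex `Kⁿ → Kⁿ⁺¹ → Kⁿ⁺²`. [cite: Weibel1994, §1.1 (Def. 1.1.1)] -/
abbrev scK (K : CochainComplex AddCommGrpCat.{w} ℕ) (n : ℕ) : ShortComplex AddCommGrpCat.{w} :=
  K.sc' n (n + 1) (n + 2)

/-- The short complex `Lⁿ → Lⁿ⁺¹ → Lⁿ⁺²` (integer indices of natural numbers). [cite: Weibel1994, §1.1 (Def. 1.1.1)] -/
abbrev scL (L : CochainComplex (ModuleCat.{v} A) ℤ) (n : ℕ) : ShortComplex (ModuleCat.{v} A) :=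
  L.sc' (n : ℤ) ((n + 1 : ℕ) : ℤ) ((n + 2 : ℕ) : ℤ)

/-- The `(n+1)`-cocycles of `K`, `ker(dⁿ⁺¹ : Kⁿ⁺¹ → Kⁿ⁺²)`. [cite: Weibel1994, §1.1 (Def. 1.1.1)] -/
abbrev ZK (K : CochainComplex AddCommGrpCat.{w} ℕ) (n : ℕ) : AddSubgroup ((scK K n).X₂) :=
  AddMonoidHom.ker (scK K n).g.hom

/-- The `(n+1)`-cocycles of `L`, `ker(dⁿ⁺¹ : Lⁿ⁺¹ → Lⁿ⁺²)`. [cite: Weibel1994, §1.1 (Def. 1.1.1)] -/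
abbrev ZL (L : CochainComplex (ModuleCat.{v} A) ℤ) (n : ℕ) : Submodule A ((scL L n).X₂) :=
  LinearMap.ker (scL L n).g.hom

/-- `e` in degree `n + 1`, retyped on the middle objects of the short complexes. [cite: Weibel1994, §1.1 (Def. 1.1.1)] -/
abbrev e₂ (n : ℕ) : ((scK K n).X₂ : Type w) ≃+ ((scL L n).X₂ : Type v) := e (n + 1)

include he in
/-- The differentials `dⁿ⁺¹` correspond under `e`. [cite: Weibel1994, §1.1 (Ex. 1.1.2)] -/
lemma e_g (n : ℕ) (x : (scK K n).X₂) : e (n + 2) ((scK K n).g.hom x) = (scL L n).g.hom (e₂ e n x) :=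
  he (n + 1) x

include he in
/-- The differentials `dⁿ` correspond under `e`. [cite: Weibel1994, §1.1 (Ex. 1.1.2)] -/
lemma e_f (n : ℕ) (x : (scK K n).X₁) : e₂ e n ((scK K n).f.hom x) = (scL L n).f.hom (e n x) :=
  he n x

include he in
/-- `e` carries `ker dⁿ⁺¹_K` into `ker dⁿ⁺¹_L`. [cite: Weibel1994, §1.1 (Ex. 1.1.2)] -/
lemma map_mem_ker (n : ℕ) (x : ZK K n) : e₂ e n x.1 ∈ ZL L n := by
  have hx : (scK K n).g.hom x.1 = 0 := x.2
  change (scL L n).g.hom (e₂ e n x.1) = 0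
  rw [← e_g e he n x.1, hx]
  exact map_zero (e (n + 2))

include he in
/-- `e⁻¹` carries `ker dⁿ⁺¹_L` into `ker dⁿ⁺¹_K`. [cite: Weibel1994, §1.1 (Ex. 1.1.2)] -/
lemma symm_map_mem_ker (n : ℕ) (y : ZL L n) : (e₂ e n).symm y.1 ∈ ZK K n := by
  have hy : (scL L n).g.hom y.1 = 0 := y.2
  change (scK K n).g.hom ((e₂ e n).symm y.1) = 0
  apply (e (n + 2)).injective
  rw [e_g e he n, AddEquiv.apply_symm_apply, hy]
  exact (map_zero (e (n + 2))).symm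

/-- **`ker dⁿ⁺¹_K ≃+ ker dⁿ⁺¹_L`.** [cite: Weibel1994, §1.1 (Ex. 1.1.2)] -/
def kerAddEquiv (n : ℕ) : ZK K n ≃+ ZL L n where
  toFun x := ⟨e₂ e n x.1, map_mem_ker e he n x⟩
  invFun y := ⟨(e₂ e n).symm y.1, symm_map_mem_ker e he n y⟩
  left_inv x := Subtype.ext ((e₂ e n).symm_apply_apply x.1)
  right_inv y := Subtype.ext ((e₂ e n).apply_symm_apply y.1)
  map_add' x y := Subtype.ext (map_add (e₂ e n) x.1 y.1)

/-- Formula. [cite: Weibel1994, §1.1 (Ex. 1.1.2)] -/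
@[simp] lemma kerAddEquiv_apply_val (n : ℕ) (x : ZK K n) :
    (kerAddEquiv e he n x).1 = e₂ e n x.1 := rfl

/-- `e` carries the boundaries `Im dⁿ_K` onto the boundaries `Im dⁿ_L`. [cite: Weibel1994, §1.1 (Ex. 1.1.2)] -/
lemma map_range_eq (n : ℕ) :
    AddSubgroup.map (kerAddEquiv e he n).toAddMonoidHom (scK K n).abToCycles.range =
      (LinearMap.range (scL L n).moduleCatToCycles).toAddSubgroup := by
  ext y
  constructor
  · rintro ⟨x, ⟨x₁, rfl⟩, rfl⟩
    refine ⟨e n x₁, Subtype.ext ?_⟩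
    change (scL L n).f.hom (e n x₁) = e₂ e n ((scK K n).f.hom x₁)
    rw [e_f e he]
  · rintro ⟨y₁, rfl⟩
    refine ⟨(scK K n).abToCycles ((e n).symm y₁), ⟨_, rfl⟩, Subtype.ext ?_⟩
    change e₂ e n ((scK K n).f.hom ((e n).symm y₁)) = (scL L n).f.hom y₁
    rw [e_f e he, AddEquiv.apply_symm_apply]

/-- `ker dⁿ⁺¹_K ⧸ Im dⁿ_K ≃+ ker dⁿ⁺¹_L ⧸ Im dⁿ_L` (the module quotient on the right, as an additive group).
[cite: Weibel1994, §1.1 (Def. 1.1.1, Ex. 1.1.2)] -/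
def kerQuotAddEquiv (n : ℕ) :
    ZK K n ⧸ (scK K n).abToCycles.range ≃+ (ZL L n ⧸ LinearMap.range (scL L n).moduleCatToCycles) :=
  QuotientAddGroup.congr _ _ (kerAddEquiv e he n) (map_range_eq e he n)

/-- Formula on classes. [cite: Weibel1994, §1.1 (Ex. 1.1.2)] -/
lemma kerQuotAddEquiv_mk (n : ℕ) (x : ZK K n) :
    kerQuotAddEquiv e he n (QuotientAddGroup.mk x) = Submodule.Quotient.mk (kerAddEquiv e he n x) :=
  rfl

/-- The concrete description of `Hⁿ⁺¹(K)` (`ker ⧸ Im`, Mathlib `abHomologyIso`). [cite: Weibel1994, §1.1 (Def. 1.1.1)] -/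
def isoK (K : CochainComplex AddCommGrpCat.{w} ℕ) (n : ℕ) :
    K.homology (n + 1) ≅
      AddCommGrpCat.of (AddMonoidHom.ker (scK K n).g.hom ⧸ (scK K n).abToCycles.range) :=
  K.homologyIsoSc' n (n + 1) (n + 2) (CochainComplex.prev_nat_succ n) (CochainComplex.next ℕ (n + 1)) ≪≫
    ShortComplex.abHomologyIso _

/-- The concrete description of `Hⁿ⁺¹(L)` (`ker ⧸ Im`, Mathlib `moduleCatHomologyIso`). [cite: Weibel1994, §1.1 (Def. 1.1.1)] -/
def isoL (L : CochainComplex (ModuleCat.{v} A) ℤ) (n : ℕ) :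
    L.homology ((n + 1 : ℕ) : ℤ) ≅ (scL L n).moduleCatLeftHomologyData.H :=
  L.homologyIsoSc' (n : ℤ) ((n + 1 : ℕ) : ℤ) ((n + 2 : ℕ) : ℤ)
      (by rw [CochainComplex.prev]; push_cast; ring) (by rw [CochainComplex.next]; push_cast; ring) ≪≫
    ShortComplex.moduleCatHomologyIso _

/-- **`Hⁿ⁺¹(K) ≃+ Hⁿ⁺¹(L)`** for degreewise additive bijections `e` intertwining the differentials.
[cite: Weibel1994, §1.1 (Ex. 1.1.2)] -/
def homologyAddEquiv (n : ℕ) :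
    (K.homology (n + 1) : Type w) ≃+ (L.homology ((n + 1 : ℕ) : ℤ) : Type v) :=
  ((isoK K n).addCommGroupIsoToAddEquiv.trans (kerQuotAddEquiv e he n)).trans
    (isoL L n).toLinearEquiv.toAddEquiv.symm

/-! ### Scalars -/

variable {ψ : K ⟶ K} {a : A} (hψ : ∀ (n : ℕ) (x : K.X n), e n ((ψ.f n).hom x) = a • e n x)

include hψ in
/-- On `ker ⧸ Im`, `ψ` is carried to multiplication by `a`. [cite: Weibel1994, §1.1 (Ex. 1.1.2)] -/
lemma kerQuotAddEquiv_kerQuotMapOf (n : ℕ)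
    (q : AddMonoidHom.ker (scK K n).g.hom ⧸ (scK K n).abToCycles.range) :
    kerQuotAddEquiv e he n (AcyclicResolution.kerQuotMapOf ψ n (n + 1) (n + 2) q) =
      a • kerQuotAddEquiv e he n q := by
  induction q using QuotientAddGroup.induction_on with
  | H x =>
    change kerQuotAddEquiv e he n (QuotientAddGroup.mk (AcyclicResolution.kerMapOf ψ n (n + 1) (n + 2) x)) = _
    rw [kerQuotAddEquiv_mk, kerQuotAddEquiv_mk, ← Submodule.Quotient.mk_smul]
    congr 1
    apply Subtype.ext
    rw [kerAddEquiv_apply_val, AcyclicResolution.kerMapOf_apply_val, Submodule.coe_smul,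
      kerAddEquiv_apply_val]
    exact hψ (n + 1) x.1

include hψ in
/-- **`Hⁿ⁺¹(ψ)` is carried to multiplication by `a`** when `ψ` acts through `e` as the scalar `a`.
[cite: Weibel1994, §1.1 (Ex. 1.1.2)] -/
theorem homologyAddEquiv_homologyMap_of_smul (n : ℕ) (y : K.homology (n + 1)) :
    homologyAddEquiv e he n ((HomologicalComplex.homologyMap ψ (n + 1)).hom y) =
      a • homologyAddEquiv e he n y := by
  have hc := AcyclicResolution.homologyMap_concreteOf ψ n (n + 1) (n + 2) (CochainComplex.prev_nat_succ n)
    (CochainComplex.next ℕ (n + 1))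
  have hc' : (isoK K n).hom.hom ((HomologicalComplex.homologyMap ψ (n + 1)).hom y) =
      AcyclicResolution.kerQuotMapOf ψ n (n + 1) (n + 2) ((isoK K n).hom.hom y) := by
    change ((HomologicalComplex.homologyMap ψ (n + 1)) ≫ (isoK K n).hom).hom y = _
    unfold isoK
    rw [hc]
    rfl
  change (isoL L n).toLinearEquiv.symm (kerQuotAddEquiv e he n ((isoK K n).hom.hom _)) =
    a • (isoL L n).toLinearEquiv.symm (kerQuotAddEquiv e he n ((isoK K n).hom.hom y))
  rw [hc', kerQuotAddEquiv_kerQuotMapOf e he hψ]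
  exact (isoL L n).toLinearEquiv.symm.map_smul a _

end HomologyTransfer

/-! ### Finiteness along a semilinear additive bijection -/

/-- **Finiteness descends along an additive bijection semilinear for a surjective ring map**: if
`f : M ≃+ N` satisfies `f (c • x) = σ(c) • f x` with `σ : k → A` surjective and `N` is a finitely
generated `A`-module, then `M` is a finitely generated `k`-module. [cite: Weibel1994, §1.1 (Ex. 1.1.2)] -/
theorem _root_.Module.Finite.of_addEquiv_semilinear {k : Type*} {A : Type*} [Semiring k] [Semiring A]
    (σ : k →+* A) (hσ : Function.Surjective σ) {M N : Type*} [AddCommMonoid M] [AddCommMonoid N]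
    [Module k M] [Module A N] (f : M ≃+ N) (hf : ∀ (c : k) (x : M), f (c • x) = σ c • f x)
    [hN : Module.Finite A N] : Module.Finite k M := by
  classical
  obtain ⟨S, hS⟩ := hN.fg_top
  refine ⟨⟨S.image f.symm, ?_⟩⟩
  rw [eq_top_iff]
  rintro x -
  have hx : f x ∈ Submodule.span A (S : Set N) := by rw [hS]; trivial
  -- induction on the span membership of `f x`
  suffices h : ∀ y ∈ Submodule.span A (S : Set N), f.symm y ∈ Submodule.span k (S.image f.symm : Set M) by
    simpa using h (f x) hx
  intro y hy
  induction hy using Submodule.span_induction with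
  | mem z hz =>
    exact Submodule.subset_span (Finset.mem_coe.2 (Finset.mem_image_of_mem _ hz))
  | zero => rw [map_zero]; exact zero_mem _
  | add y z _ _ hy hz => rw [map_add]; exact add_mem hy hz
  | smul b y _ hy =>
    obtain ⟨c, rfl⟩ := hσ b
    have : f.symm (σ c • y) = c • f.symm y := by
      apply f.injective
      rw [f.apply_symm_apply, hf, f.apply_symm_apply]
    rw [this]
    exact Submodule.smul_mem _ c hy

end Literature.Algebra.Homology

end
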